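import Literature.NumberTheory.LFunctions.UniformClassGroupPNT
import Literature.NumberTheory.LFunctions.DedekindZetaUniformBounds
import Literature.NumberTheory.LFunctions.PrimeIdealPsi
import Literature.NumberTheory.QuadraticFields.DedekindZetaReducedForms
import Mathlib.NumberTheory.Chebyshev
import Mathlib.NumberTheory.NumberField.InfinitePlace.TotallyRealComplex
import HarnessLib

/-!
# Elementary inputs for the uniform prime ideal theorem in ideal classes

Topic `Literature/NumberTheory/LFunctions` (namespace `Literature.NumberTheory.LFunctions.NumberField`),
sibling of `UniformClassGroupPNT.lean` (named fact
`ThornerZaman2019_classPNT_imaginaryQuadratic`, [ThornerZaman2019, Thm. 1.4]).  Everything here is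
PROVED (theorems only).  These are the elementary, field-uniform inputs used to absorb the
secondary error terms in the last step of the proof of [ThornerZaman2019, Thm. 5.1]
(`𝓔₀(x) ≪ x^{1/2}`, absorbed by (4.8); "Minkowski's estimate", "trivially estimating the number of
prime ideal powers") for the Hilbert class field of an imaginary quadratic field:

* `chebyshevPsiIdeal_le_finrank_mul_psi`, `chebyshevThetaIdeal_le_mul` — the Chebyshev bound
  `θ_K(x) ≤ ψ_K(x) ≤ [K:ℚ] ψ(x) ≤ [K:ℚ](log 4 + 4) x`, uniform in `K` (tree:
  `vonMangoldtIdeal_le_finrank_mul_vonMangoldt`; Mathlib: `Chebyshev.psi_le_const_mul_self`);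
* real class group characters take the values `±1` (`classGroupChar_apply_eq_one_or_eq_neg_one`,
  `re_classGroupChar_apply`, `classGroupChar_apply_eq_ofReal_re`);
* the error term `errorTerm c Q x = e^{−c log x/log Q} + e^{−√(c log x/2)}` is non-increasing in
  `x ≥ 1` and `errorTerm c Q (√x) = errorTerm (c/2) Q x` (`ThornerZaman.errorTerm_antitoneOn`,
  `ThornerZaman.errorTerm_sqrt`);
* an imaginary quadratic field has `d_K < 0`, `Q = 4|d_K| ≥ 12` (`discr_neg_of_isTotallyComplex`,
  `ThornerZaman.twelve_le_condQ`) and **`h_K ≤ d_K²`** (`classNumber_le_discr_sq`, from the tree's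
  `h(d_K) = h_K`, `Quadratic.card_reducedForms_eq_classNumber`, Cox Thm. 7.7(ii), and the crude
  count of reduced forms in the box `1 ≤ a ≤ |D|/3`, `|b| ≤ |D|/3`).

## References

* J. Thorner, A. Zaman, *A unified and improved Chebotarev density theorem*, Algebra Number
  Theory 13 (2019) 1039–1068, §5.1. [ThornerZaman2019]
* D. A. Cox, *Primes of the form `x² + ny²`*, 2nd ed., Thm. 2.13, Thm. 7.7. [Cox2013]
-/

noncomputable section

open scoped NumberField
open Finset Real NumberField

namespace Literature.NumberTheory.LFunctions.NumberField

variable {K : Type*} [Field K] [NumberField K]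

/-! ### Chebyshev's bound, uniformly in the field -/

variable (K) in
/-- **`ψ_K(x) ≤ [K:ℚ] ψ(x)`** (termwise `Λ_K(n) ≤ [K:ℚ] Λ(n)`, Landau 1903 §11).
[cite: LandauMathAnn1903, §11 p. 668] -/
theorem chebyshevPsiIdeal_le_finrank_mul_psi (x : ℝ) :
    chebyshevPsiIdeal K x ≤ Module.finrank ℚ K * Chebyshev.psi x := by
  rw [chebyshevPsiIdeal, Chebyshev.psi_eq_sum_Icc, mul_sum]
  exact sum_le_sum fun n _ ↦ vonMangoldtIdeal_le_finrank_mul_vonMangoldt K n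

variable (K) in
/-- **`θ_K(x) ≤ [K:ℚ] (log 4 + 4) x`** for `x ≥ 0`: Chebyshev's bound (Mathlib
`Chebyshev.psi_le_const_mul_self`) carried to number fields, uniformly in `K`. [folklore] -/
theorem chebyshevThetaIdeal_le_mul {x : ℝ} (hx : 0 ≤ x) :
    chebyshevThetaIdeal K x ≤ Module.finrank ℚ K * (Real.log 4 + 4) * x := by
  refine (chebyshevThetaIdeal_le_chebyshevPsiIdeal K x).trans
    ((chebyshevPsiIdeal_le_finrank_mul_psi K x).trans ?_)
  rw [mul_assoc]
  exact mul_le_mul_of_nonneg_left (Chebyshev.psi_le_const_mul_self hx) (Nat.cast_nonneg _)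

/-! ### Real class group characters -/

omit [NumberField K] in
/-- A real class group character (`χ² = 1`) takes the values `±1`. [folklore] -/
theorem classGroupChar_apply_eq_one_or_eq_neg_one {χ : ClassGroup (𝓞 K) →* ℂˣ} (hχ : χ * χ = 1)
    (C : ClassGroup (𝓞 K)) : (χ C : ℂ) = 1 ∨ (χ C : ℂ) = -1 := by
  have h := DFunLike.congr_fun hχ C
  rw [MonoidHom.mul_apply, MonoidHom.one_apply] at h
  have h2 : (χ C : ℂ) ^ 2 = 1 := by
    rw [sq, ← Units.val_mul, h, Units.val_one]
  exact sq_eq_one_iff.mp h2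

omit [NumberField K] in
/-- The real part of a value of a real class group character is `±1`. [folklore] -/
theorem re_classGroupChar_apply {χ : ClassGroup (𝓞 K) →* ℂˣ} (hχ : χ * χ = 1)
    (C : ClassGroup (𝓞 K)) : ((χ C : ℂ)).re = 1 ∨ ((χ C : ℂ)).re = -1 := by
  rcases classGroupChar_apply_eq_one_or_eq_neg_one hχ C with h | h <;> simp [h]

omit [NumberField K] in
/-- `|Re χ(C)| ≤ 1` for a real class group character. [folklore] -/
theorem abs_re_classGroupChar_apply_le {χ : ClassGroup (𝓞 K) →* ℂˣ} (hχ : χ * χ = 1)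
    (C : ClassGroup (𝓞 K)) : |((χ C : ℂ)).re| ≤ 1 := by
  rcases re_classGroupChar_apply hχ C with h | h <;> simp [h]

omit [NumberField K] in
/-- A value of a real class group character is (the complexification of) its real part.
[folklore] -/
theorem classGroupChar_apply_eq_ofReal_re {χ : ClassGroup (𝓞 K) →* ℂˣ} (hχ : χ * χ = 1)
    (C : ClassGroup (𝓞 K)) : (χ C : ℂ) = ((((χ C : ℂ)).re : ℝ) : ℂ) := by
  rcases classGroupChar_apply_eq_one_or_eq_neg_one hχ C with h | h <;> simp [h]

/-! ### The error term -/

namespace ThornerZaman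

/-- `errorTerm c Q (√x) = errorTerm (c/2) Q x` (`log √x = (log x)/2`). [folklore] -/
theorem errorTerm_sqrt (c Q : ℝ) {x : ℝ} (hx : 0 ≤ x) :
    errorTerm c Q (Real.sqrt x) = errorTerm (c / 2) Q x := by
  simp only [errorTerm, Real.log_sqrt hx]
  ring_nf

/-- The error term is non-increasing in `x ≥ 1` (for `c ≥ 0`, `Q > 1`). [folklore] -/
theorem errorTerm_antitoneOn {c Q : ℝ} (hc : 0 ≤ c) (hQ : 1 < Q) :
    AntitoneOn (errorTerm c Q) (Set.Ici 1) := by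
  intro a ha b _ hab
  have ha1 : (1 : ℝ) ≤ a := ha
  have hlog : Real.log a ≤ Real.log b := Real.log_le_log (by linarith) hab
  have hQ' : 0 < Real.log Q := Real.log_pos hQ
  unfold errorTerm
  refine add_le_add (Real.exp_le_exp.mpr ?_) (Real.exp_le_exp.mpr ?_)
  · have : c * Real.log a / Real.log Q ≤ c * Real.log b / Real.log Q :=
      div_le_div_of_nonneg_right (mul_le_mul_of_nonneg_left hlog hc) hQ'.le
    linarith
  · have : Real.sqrt (c * Real.log a / 2) ≤ Real.sqrt (c * Real.log b / 2) :=
      Real.sqrt_le_sqrt (by nlinarith)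
    linarith

/-- The error term dominates its first summand: `e^{−c log x/log Q} ≤ errorTerm c Q x`.
[folklore] -/
theorem exp_le_errorTerm (c Q x : ℝ) :
    Real.exp (-(c * Real.log x / Real.log Q)) ≤ errorTerm c Q x :=
  le_add_of_nonneg_right (Real.exp_nonneg _)

/-- `Q = 4|d_K| ≥ 12` when `[K:ℚ] > 1` (Minkowski: `|d_K| > 2`, Mathlib `NumberField.abs_discr_gt_two`).
[folklore] -/
theorem twelve_le_condQ (h2 : 1 < Module.finrank ℚ K) : 12 ≤ condQ K := by
  have h := NumberField.abs_discr_gt_two h2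
  have h3 : (3 : ℝ) ≤ |(NumberField.discr K : ℝ)| := by
    rw [← Int.cast_abs]
    exact_mod_cast (show (3 : ℤ) ≤ |NumberField.discr K| by omega)
  unfold condQ
  linarith

end ThornerZaman

/-! ### Imaginary quadratic fields: sign of the discriminant and a crude class number bound -/

/-- A totally complex quadratic field has negative discriminant (`sign d_K = (−1)^{r₂}`,
Mathlib `NumberField.sign_discr`, with `r₂ = 1`). [folklore] -/
theorem discr_neg_of_isTotallyComplex (h2 : Module.finrank ℚ K = 2) (hc : IsTotallyComplex K) :
    NumberField.discr K < 0 := by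
  haveI := hc
  have h1 : InfinitePlace.nrComplexPlaces K = 1 := by
    have := IsTotallyComplex.finrank K
    omega
  have h := NumberField.sign_discr K
  rw [h1, pow_one] at h
  exact Int.sign_eq_neg_one_iff_neg.mp h

/-- The reduced forms of discriminant `D` are at most `(|D|/3)(2(|D|/3) + 1)` in number (they are
indexed by `(a, b)` in the box `1 ≤ a ≤ |D|/3`, `|b| ≤ |D|/3`; Cox §2.A). [folklore] -/
theorem card_reducedForms_le (D : ℤ) :
    (QuadraticFields.BinaryQuadraticForm.reducedForms D).card ≤
      (D.natAbs / 3) * (2 * (D.natAbs / 3) + 1) := by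
  unfold QuadraticFields.BinaryQuadraticForm.reducedForms QuadraticFields.BinaryQuadraticForm.coeffBound
  refine card_image_le.trans ((card_filter_le _ _).trans ?_)
  rw [card_product, Int.card_Icc, Int.card_Icc]
  have h1 : ((D.natAbs / 3 : ℕ) + 1 - 1 : ℤ).toNat = D.natAbs / 3 := by omega
  have h2 : ((D.natAbs / 3 : ℕ) + 1 - -((D.natAbs / 3 : ℕ) : ℤ)).toNat = 2 * (D.natAbs / 3) + 1 := by
    omega
  rw [h1, h2]

/-- **`h_K ≤ d_K²`** for an imaginary quadratic field (crude: `h_K = h(d_K)` is the number of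
reduced forms of discriminant `d_K`, the tree's `Quadratic.card_reducedForms_eq_classNumber`,
Cox Thm. 7.7(ii), and there are at most `(|d_K|/3)(2|d_K|/3 + 1) ≤ d_K²` of them).
[cite: Cox2013, §7.B Thm. 7.7(ii)] -/
theorem classNumber_le_discr_sq (h2 : Module.finrank ℚ K = 2) (hc : IsTotallyComplex K) :
    (classNumber K : ℝ) ≤ (NumberField.discr K : ℝ) ^ 2 := by
  have hd := discr_neg_of_isTotallyComplex h2 hc
  have h := QuadraticFields.Quadratic.card_reducedForms_eq_classNumber h2 hd
  rw [QuadraticFields.BinaryQuadraticForm.classNumber] at h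
  have hle := card_reducedForms_le (NumberField.discr K)
  rw [h] at hle
  set n : ℕ := (NumberField.discr K).natAbs with hn
  have hcast : ((NumberField.discr K : ℝ)) ^ 2 = ((n : ℕ) : ℝ) ^ 2 := by
    rw [hn, Nat.cast_natAbs, Int.cast_abs, sq_abs]
  rw [hcast]
  have hn3 : 3 ≤ n := by
    have h3 : 2 < |NumberField.discr K| := NumberField.abs_discr_gt_two (by omega)
    have h4 : ((n : ℕ) : ℤ) = |NumberField.discr K| := by rw [hn, Int.natCast_natAbs]
    omega
  have hn1 : (1 : ℝ) ≤ n := by exact_mod_cast (show 1 ≤ n by omega)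
  have hq : ((n / 3 : ℕ) : ℝ) ≤ (n : ℝ) / 3 := Nat.cast_div_le
  have hle' : (classNumber K : ℝ) ≤ ((n / 3 : ℕ) : ℝ) * (2 * ((n / 3 : ℕ) : ℝ) + 1) := by
    exact_mod_cast hle
  have hq0 : 0 ≤ ((n / 3 : ℕ) : ℝ) := Nat.cast_nonneg _
  nlinarith [mul_le_mul hq hq hq0 (by positivity : (0 : ℝ) ≤ n / 3)]

/-- `1 ≤ h_K` (the class group is nonempty). [folklore] -/
theorem one_le_classNumber : 1 ≤ classNumber K := by
  unfold classNumber
  exact Fintype.card_pos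

end Literature.NumberTheory.LFunctions.NumberField

end
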